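import Literature.Geometry.Riemannian.MetricCutoff
import HarnessLib

/-!
# Helper `helper_metricCutoffComplete_of` of line `collapsed-ends-usc` (crux
# `EntropyRung.NoncompactShrinkerGap`, stmt-SmoothPoincare4-10868): Topping's metric cut-offs on a
# complete manifold, from the compact-support smoothing statement

Registered helper stub S2 of the κ-noncollapsing programme (Perelman's no local collapsing of a
complete gradient shrinking soliton, brick 2 of route item 16588): the smooth version of Topping's
test cut-off `ψ(d(x, p)/s)` (Topping 2006, §8.3, proof of Lemma 8.3.5; Perelman 2002, §4, proof of
Thm. 4.1) on a COMPLETE, possibly non-compact, manifold, completeness being given in Heine–Borel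
form (closed `d_g`-balls `{y | d_g(x, y) ≤ r}` are compact), with a universal gradient constant:
`χ ∈ C^∞_c(M; [0, 1])`, `χ = 1` on `B(p, s/2)`, `tsupport χ ⊆ B(p, s)`, `|∇χ|²_g ≤ C₀/s²`.
The statement is conditional on the smoothing statement S1 (registered helper
`helper_lipschitzSmoothingCompactSupport` = the Literature theorem
`exists_contMDiff_approx_of_hasCompactSupport` at universe `Type`: smoothing of compactly supported
Lipschitz functions with gradient and support control on σ-compact manifolds), taken as the
hypothesis. The proof is that of `exists_cutoff_of_isGeodesicallyComplete`
(`Literature/Geometry/Riemannian/CompleteManifoldCutoff.lean`) with the Hopf–Rinow step replaced by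
the Heine–Borel hypothesis: the `4/s`-Lipschitz raw cut-off `θ(min(d(p, ·), s)/s)` of
`exists_raw_cutoff` (`MetricCutoff.lean`) is positive only in `B(p, 3s/4)`, hence supported in the
compact closed ball of radius `3s/4`; it is smoothed to within `min (1/8) (1/s)` with gradient
`≤ 4/s + 1/s` by the hypothesis, and clamped by the smooth clamp `Λ` of `exists_smooth_clamp`
(`Λ = 0` on `(-∞, 1/4]`, `Λ = 1` on `[3/4, ∞)`, `|Λ'| ≤ C`), `χ = Λ ∘ χ̃`, so that `C₀ = 25 C²`.
Everything is proved; no definitions, no named facts.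
-/

noncomputable section

-- `Summit.SmoothPoincare4.SmoothPoincare4.…` (summit = problem) trips `dupNamespace` on every decl.
set_option linter.dupNamespace false

open scoped Manifold ContDiff ENNReal NNReal Topology
open MeasureTheory Set Filter Module
open Literature.Geometry.Lorentzian Literature.Geometry.Riemannian

namespace Summit.SmoothPoincare4.SmoothPoincare4.Theorems.NoncompactShrinkerGapNoncollapsing

/-- Registered helper `helper_metricCutoffComplete_of` (stub S2, of S1): **smooth cut-offs adapted to
geodesic balls on a complete manifold, with a universal gradient bound.** Granting the smoothing
statement S1 (compactly supported Lipschitz `F` on a σ-compact manifold ⇒ `χ ∈ C^∞_c(U)` with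
`|χ - F| < ε`, `|∇χ|²_g ≤ (L + ε)²`), there is a universal constant `C₀` such that for every smooth
Riemannian metric `g` on a Hausdorff, locally compact, σ-compact, regular manifold (boundaryless
finite-dimensional model) all of whose closed distance balls `{y | d_g(x, y) ≤ r}` are compact, every
`p` and every `s > 0`, there is a `C^∞` compactly supported `χ : M → [0, 1]` with `χ = 1` on the
geodesic ball `B(p, s/2)`, `tsupport χ ⊆ B(p, s)` and `|∇χ|²_g ≤ C₀/s²` everywhere — Topping's
test cut-off `ψ(d(x, p)/r)` ("`|∇φ| ≤ (1/r) sup|ψ'|`, by approximation") made smooth: the raw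
`4/s`-Lipschitz cut-off of `exists_raw_cutoff`, compactly supported in the closed `3s/4`-ball,
smoothed by S1 to within `min (1/8) (1/s)` and clamped with `exists_smooth_clamp`; `C₀ = 25 sup|Λ'|²`.
[cite: Topping2006, §8.3, proof of Lemma 8.3.5] -/
theorem helper_metricCutoffComplete_of : (∀ {E : Type} [NormedAddCommGroup E] [NormedSpace ℝ E] [FiniteDimensional ℝ E] {H : Type} [TopologicalSpace H] (I : ModelWithCorners ℝ E H) [I.Boundaryless] (M : Type) [TopologicalSpace M] [T2Space M] [LocallyCompactSpace M] [SigmaCompactSpace M] [ChartedSpace H M] [IsManifold I ∞ M] (g : PseudoRiemannianMetric I ∞ E (TangentSpace I : M → Type _)) (hg : g.IsRiemannian) (F : M → ℝ), Continuous F → HasCompactSupport F → ∀ L : ℝ, 0 ≤ L → (∀ x y, ENNReal.ofReal |F x - F y| ≤ ENNReal.ofReal L * g.edist hg x y) → ∀ U : Set M, IsOpen U → tsupport F ⊆ U → ∀ ε : ℝ, 0 < ε → ∃ χ : M → ℝ, ContMDiff I 𝓘(ℝ, ℝ) ∞ χ ∧ HasCompactSupport χ ∧ tsupport χ ⊆ U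 ∧ (∀ x, |χ x - F x| < ε) ∧ ∀ x, g.gradSq χ x ≤ (L + ε) ^ 2) → ∃ C₀ : ℝ, ∀ {E : Type} [NormedAddCommGroup E] [NormedSpace ℝ E] [FiniteDimensional ℝ E] {H : Type} [TopologicalSpace H] (I : ModelWithCorners ℝ E H) [I.Boundaryless] (M : Type) [TopologicalSpace M] [T2Space M] [LocallyCompactSpace M] [SigmaCompactSpace M] [T3Space M] [ChartedSpace H M] [IsManifold I ∞ M] (g : PseudoRiemannianMetric I ∞ E (TangentSpace I : M → Type _)) (hg : g.IsRiemannian), (∀ (x : M) (r : NNReal), IsCompact {y : M | g.edist hg x y ≤ r}) → ∀ (p : M) (s : ℝ), 0 < s → ∃ χ : M → ℝ, ContMDiff I 𝓘(ℝ, ℝ) ∞ χ ∧ HasCompactSupport χ ∧ (∀ x, 0 ≤ χ x) ∧ (∀ x, χ x ≤ 1) ∧ (∀ x ∈ g.ball p (ENNReal.ofReal (s / 2)), χ x = 1) ∧ tsupport χ ⊆ g.ball p (ENNReal.ofReal s) ∧ ∀ x, g.gradSq χ x ≤ C₀ / s ^ 2 := by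
  intro hS1
  obtain ⟨Λ, C, _, hΛs, hΛ0, hΛ1, hΛzero, hΛone, hΛd⟩ := exists_smooth_clamp
  refine ⟨25 * C ^ 2, ?_⟩
  intro E _ _ _ H _ I _ M _ _ _ _ _ _ _ g hg hc p s hs
  -- the raw cutoff: continuous, `[0,1]`-valued, `= 1` on `B(p, s/2)`, `> 0` only in `B(p, 3s/4)`
  obtain ⟨F, hFc, hF0, -, hFone, hFpos, hFlip⟩ := exists_raw_cutoff hg p hs
  -- it has compact support: the closed ball of radius `3s/4` is compact by hypothesis
  have hFk : HasCompactSupport F := by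
    refine HasCompactSupport.of_support_subset_isCompact (hc p (3 * s / 4).toNNReal)
      fun x hx ↦ ?_
    have hx' : 0 < F x := lt_of_le_of_ne (hF0 x) (Ne.symm hx)
    exact (hFpos x hx').le
  set ε : ℝ := min (1 / 8) (1 / s) with hε
  have hεpos : 0 < ε := by positivity
  have hε8 : ε ≤ 1 / 8 := min_le_left _ _
  have hεs : ε ≤ 1 / s := min_le_right _ _
  -- the smoothing of `F` to within `ε`, with gradient `≤ 4/s + ε`
  obtain ⟨χt, hχts, hχtk, -, hχtF, hχtgrad⟩ :=
    hS1 I M g hg F hFc hFk (4 / s) (by positivity) hFlip univ isOpen_univ (subset_univ _) ε hεpos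
  -- the clamped cutoff
  refine ⟨fun x ↦ Λ (χt x), hΛs.comp_contMDiff hχts, ?_, fun x ↦ hΛ0 _, fun x ↦ hΛ1 _,
    fun x hx ↦ ?_, ?_, fun x ↦ ?_⟩
  · -- compact support: `Λ 0 = 0`
    exact hχtk.comp_left (hΛzero 0 (by norm_num))
  · -- `= 1` on `B(p, s/2)`: there `F = 1`, so `χt > 7/8 ≥ 3/4`
    have hd : g.edist hg p x < ENNReal.ofReal (s / 2) := by
      simpa [PseudoRiemannianMetric.mem_ball, PseudoRiemannianMetric.riemEDist_eq hg] using hx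
    have h1 := hFone x hd
    have h2 := hχtF x
    rw [h1] at h2
    exact hΛone _ (by linarith [(abs_lt.1 h2).1])
  · -- support: `Λ (χt x) ≠ 0 ⇒ χt x > 1/4 ⇒ F x > 0 ⇒ d(p, x) < 3s/4 < s`
    intro x hx
    have hcl : tsupport (fun x ↦ Λ (χt x)) ⊆ {x | 1 / 4 ≤ χt x} := by
      refine closure_minimal (fun y hy ↦ ?_) (isClosed_le continuous_const hχts.continuous)
      by_contra hlt
      simp only [mem_setOf_eq, not_le] at hlt
      exact hy (hΛzero _ hlt.le)
    have hχx : 1 / 4 ≤ χt x := hcl hx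
    have hFx : 0 < F x := by linarith [(abs_lt.1 (hχtF x)).2]
    have hd := hFpos x hFx
    rw [PseudoRiemannianMetric.mem_ball, PseudoRiemannianMetric.riemEDist_eq hg]
    exact hd.trans_le (ENNReal.ofReal_le_ofReal (by linarith))
  · -- gradient: `|∇(Λ ∘ χt)|² = Λ'(χt)² |∇χt|² ≤ C² (4/s + ε)² ≤ 25 C²/s²`
    have hd : HasDerivAt Λ (deriv Λ (χt x)) (χt x) :=
      ((hΛs.differentiable (by simp)) _).hasDerivAt
    have hmd : MDifferentiableAt I 𝓘(ℝ, ℝ) χt x := (hχts x).mdifferentiableAt (by simp)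
    rw [show (fun x ↦ Λ (χt x)) = Λ ∘ χt from rfl, g.gradSq_real_comp hd hmd]
    have h1 : deriv Λ (χt x) ^ 2 ≤ C ^ 2 := by
      rw [← sq_abs]
      exact pow_le_pow_left₀ (abs_nonneg _) (hΛd _) 2
    have h2 : g.gradSq χt x ≤ (5 / s) ^ 2 := by
      refine (hχtgrad x).trans (pow_le_pow_left₀ (by positivity) ?_ 2)
      calc 4 / s + ε ≤ 4 / s + 1 / s := by linarith
        _ = 5 / s := by ring
    have h3 : 0 ≤ g.gradSq χt x := g.gradSq_nonneg hg χt x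
    calc deriv Λ (χt x) ^ 2 * g.gradSq χt x ≤ C ^ 2 * (5 / s) ^ 2 :=
          mul_le_mul h1 h2 h3 (sq_nonneg _)
      _ = 25 * C ^ 2 / s ^ 2 := by ring

end Summit.SmoothPoincare4.SmoothPoincare4.Theorems.NoncompactShrinkerGapNoncollapsing

end
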